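import Mathlib.CategoryTheory.SingleObj
import Mathlib.Data.Countable.Basic
import Literature.IUT.HodgeTheaters.BaseThetaDatum
import HarnessLib

/-!
# A combinatorial model of the hypothesis structure `BaseThetaDatum` ([IUTchI] §4) — consistency witness

The statements of [IUTchI] §4 (Def. 4.1 – Cor. 4.12) are typed over the hypothesis structure
`BaseThetaDatum` (`BaseThetaDatum.lean`), whose ≈ 40 fields quote the outputs of the reconstruction
algorithms invoked in Definition 4.1 / Examples 4.3–4.5. This file exhibits an INHABITANT of that structure
built from finite combinatorics only (`l = 5`, one bad place, one-object ambient categories, the group `F_5^⋇`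
acting on itself), proving that the interface is CONSISTENT — so no statement typed over it is vacuously true
for want of a model, and no field contradicts another. It is NOT the arithmetic model of Def. 3.1 (number
field, once-punctured elliptic curve, tempered fundamental groups), which is the business of layers L2–L5 of the
campaign; nothing here bears on the initial Θ-data of interest. Record-only
[claim: Mochizuki2012, status: disputed]; nothing here takes a side.
-/

namespace Literature.IUT.HodgeTheaters

open CategoryTheory

namespace BaseThetaDatum

namespace TrivialModel

/-- The prime of the model: `l = 5` (so `F_l^⋇ ≅ ℤ/2`). [claim: Mochizuki2012, status: disputed] -/
instance fact_prime_five : Fact (Nat.Prime 5) := ⟨Nat.prime_five⟩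

/-- The local ambient category of the model: one object, endomorphisms `(ℕ, +)` (only the identity is
invertible; the endomorphism `n + 1` plays the evaluation section of the `n`-th label).
[claim: Mochizuki2012, status: disputed] -/
abbrev LocAmb : Type := SingleObj (Multiplicative ℕ)

/-- The global ambient category of the model: one object with automorphism group `F_5^⋇`.
[claim: Mochizuki2012, status: disputed] -/
abbrev GlobAmb : Type := SingleObj (FlStar 5)

/-- The element of `(ℕ, +)` underlying a morphism of the local ambient category. [claim: Mochizuki2012, status: disputed] -/
abbrev lval {X Y : LocAmb} (f : X ⟶ Y) : Multiplicative ℕ := f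

/-- The element of `F_5^⋇` underlying a morphism of the global ambient category. [claim: Mochizuki2012, status: disputed] -/
abbrev gval {Y Y' : GlobAmb} (f : Y ⟶ Y') : FlStar 5 := f

/-- In the local ambient category every isomorphism is the identity. [claim: Mochizuki2012, status: disputed] -/
theorem locAmb_iso_hom_eq {X Y : LocAmb} (a : X ≅ Y) : lval a.hom = 1 := by
  have h : lval a.inv * lval a.hom = 1 := a.hom_inv_id
  have h' : Multiplicative.toAdd (lval a.inv) + Multiplicative.toAdd (lval a.hom) = 0 :=
    congrArg Multiplicative.toAdd h
  have : Multiplicative.toAdd (lval a.hom) = 0 := by omega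
  exact congrArg Multiplicative.ofAdd this

/-- `|F_5|` is finite. [claim: Mochizuki2012, status: disputed] -/
instance finite_flAbs : Finite (FlAbs 5) := Finite.of_equiv _ (flAbsEquivOption 5).symm

/-- An injection of the labels `|F_5|` into `ℕ` (to name the evaluation sections).
[claim: Mochizuki2012, status: disputed] -/
noncomputable def labelCode : FlAbs 5 → ℕ := (Countable.exists_injective_nat (FlAbs 5)).choose

/-- The label code is injective. [claim: Mochizuki2012, status: disputed] -/
theorem labelCode_injective : Function.Injective labelCode :=
  (Countable.exists_injective_nat (FlAbs 5)).choose_spec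

/-- The automorphism of the global object given by a group element. [claim: Mochizuki2012, status: disputed] -/
def globIso (g : FlStar 5) : (SingleObj.star (FlStar 5) : GlobAmb) ≅ SingleObj.star (FlStar 5) where
  hom := g
  inv := (g⁻¹ : FlStar 5)
  hom_inv_id := inv_mul_cancel g
  inv_hom_id := mul_inv_cancel g

end TrivialModel

open TrivialModel in
/-- **A model of `BaseThetaDatum`**: `l = 5`; a single (bad, nonarchimedean) place; local ambient categories
with one object and endomorphism monoid `(ℕ, +)`; global ambient category with one object and automorphism
group `F_5^⋇`; all label torsors `F_5^⋇` acting on itself; the `φ^NF`-type morphisms `F_5^⋇` with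
post-composition by multiplication; pull-back of labels along `f` = right multiplication by `f`; the label of
an automorphism read off contravariantly. Every one of the ≈ 40 axioms is checked by the kernel.
[claim: Mochizuki2012, status: disputed] -/
noncomputable def trivialModel : BaseThetaDatum.{0} where
  l := 5
  five_le_l := le_rfl
  V := Unit
  IsArc _ := False
  IsBad _ := True
  not_isArc_of_isBad _ h := h
  exists_isBad := ⟨(), trivial⟩
  Amb _ := LocAmb
  D _ := SingleObj.star _
  nonempty_iso _ X Y := ⟨Iso.refl _⟩
  AmbM _ := LocAmb
  DM _ := SingleObj.star _
  nonempty_isoM _ X Y := ⟨Iso.refl _⟩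
  mono _ X := X
  monoIso f := f
  monoIso_refl _ := rfl
  monoIso_trans _ _ := rfl
  AmbG := GlobAmb
  DG := SingleObj.star _
  nonempty_isoG X Y := ⟨Iso.refl _⟩
  Val _ := Unit
  valIso _ := Equiv.refl _
  valIso_refl _ := rfl
  valIso_trans _ _ := rfl
  valOfV := ⟨id, fun _ _ h => h⟩
  HomNF _ _ _ := FlStar 5
  preNF _ f := f
  postNF f b := f * gval b.hom
  preNF_refl _ := rfl
  preNF_trans _ _ _ := rfl
  postNF_refl f := mul_one f
  postNF_trans f b b' := by
    change f * (gval b'.hom * gval b.hom) = f * gval b.hom * gval b'.hom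
    rw [mul_assoc]
    exact congrArg (f * ·) (mul_comm (gval b'.hom) (gval b.hom))
  preNF_postNF _ _ _ := rfl
  phiNF _ := 1
  exists_eq_phiNF f := ⟨Iso.refl _, globIso f, (one_mul f).symm⟩
  LabCusp _ _ := FlStar 5
  isTorsor_labCusp _ _ := IsTorsor.self
  labIso _ := Equiv.refl _
  labIso_smul _ _ _ := rfl
  labIso_refl _ := rfl
  labIso_trans _ _ := rfl
  η _ _ := 1
  labIso_η _ := rfl
  LabCuspG _ := FlStar 5
  isTorsor_labCuspG _ := IsTorsor.self
  labIsoG b := Equiv.mulRight (gval b.hom)⁻¹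
  labIsoG_smul b j c := mul_assoc j c _
  labIsoG_refl Y := by
    ext c; change c * (1 : FlStar 5)⁻¹ = c; rw [inv_one, mul_one]
  labIsoG_trans b b' := by
    ext c
    change c * (gval b'.hom * gval b.hom)⁻¹ = c * (gval b.hom)⁻¹ * (gval b'.hom)⁻¹
    rw [mul_inv_rev, mul_assoc]
  εLab := 1
  exists_aut_smul j := ⟨globIso j⁻¹, fun c => by
    change c * (j⁻¹)⁻¹ = j * c
    rw [inv_inv]
    exact mul_comm c j⟩
  labPull f := Equiv.mulRight f
  labPull_smul f j c := mul_assoc j c f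
  labPull_preNF _ _ _ := rfl
  labPull_postNF f b c := by
    change c * (f * gval b.hom) = (Equiv.mulRight (gval b.hom)⁻¹).symm c * f
    rw [Equiv.mulRight_symm_apply, inv_inv, mul_assoc]
    exact congrArg (c * ·) (mul_comm f (gval b.hom))
  labPull_phiNF_εLab _ := mul_one 1
  IsEvalSection _ j _ _ f := lval f = Multiplicative.ofAdd (labelCode j + 1)
  isEvalSection_isoComp _ j _ _ _ a f hf := by
    change lval f * lval a.hom = _
    rw [locAmb_iso_hom_eq a, mul_one]; exact hf
  isEvalSection_compIso _ j _ _ _ f b hf := by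
    change lval b.hom * lval f = _
    rw [locAmb_iso_hom_eq b, one_mul]; exact hf
  exists_isEvalSection _ j _ _ := ⟨(Multiplicative.ofAdd (labelCode j + 1) : Multiplicative ℕ), rfl⟩
  isEvalSection_label_unique _ j j' _ _ f h h' := by
    have := h.symm.trans h'
    have := Multiplicative.ofAdd.injective this
    exact labelCode_injective (by omega)

/-- **`BaseThetaDatum` is consistent**: the hypothesis structure over which [IUTchI] §4 is typed has a model.
[claim: Mochizuki2012, status: disputed] -/
theorem nonempty_baseThetaDatum : Nonempty BaseThetaDatum.{0} := ⟨trivialModel⟩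

end BaseThetaDatum

end Literature.IUT.HodgeTheaters
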